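import Summits.QuantumFields.YangMills.Theorems.BalabanUVNodesN09ContinuousAxialCritCfg

/-!
# NODE N09 [B12] · THE AXIAL LETTER ON ALL TORI AND LEVELS AT ONCE, AND THE (2.9)-PATTERN CUT-OFF FAMILY OF AN ARBITRARY MEASURABLE LETTER — road B's χ-clauses
# `hχm ∕ hχ01 ∕ hχ1` supplied def-free for ANY letter family, and for the AXIAL letter in particular

Cell `pub-ymgap` (YM-PLAN Track A), DAG node N09 [Balaban1987RG1] (= [I]); width seat `pub-ymgap-dag-n09-w5` g7, FILE 2 (sequel of `…N09ContinuousAxialCritCfg`, p642976); count-neutral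
helper keyed to K1⁹ `StabilityBRunRowsAtRecordR13SepCoPHV` = stmt-QuantumFields-27364 (`--kind proof --supports … --as helper`).

WHY.  Road B's letter-parametric regularity tower (dag-n09-w2 g5 INTENT-9 `…N09RegularityTowerAnyCritOfLocalRoute`) quantifies over a LETTER FAMILY
`crit : (k : ℕ) → GaugeField_{k+1} → GaugeField_k` and a CUT-OFF FAMILY of the edition `χ : (K : ℕ) → (ℕ → ℝ) → (k : ℕ) → Density (F.P K) k (SU N)` (the shape NODE 00's
`TcanOfRecord` ∕ `betaInputOfRecord` read), with three displayed χ-clauses per step: `hχm : Measurable (χ K g j)`, `hχ01 : χ K g j U = 0 ∨ χ K g j U = 1`, and the (2.9) reading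
`hχ1 : χ K g k V = 1 ↔ ∀ b, ¬ IsB0 b → dist1 ((crit k (M V) b)⁻¹·V b) < ε₁` (dag-n09-w2 g5's interface note, INBOX l.39802).  For the OFFER these are K0c's
`chiFixed29Sel` facts; for the AXIAL letter of FILE 1 no cut-off is NAMED anywhere (a `def` is K0e ∕ def-T's call, not a Theorems file's).  THIS FILE supplies the clauses
WITHOUT a definition: (§1) for ANY measurable letter family `c : (K j : ℕ) → GaugeField_{j+1} → GaugeField_j` the explicit term
`χ K g k V := if (∀ b, ¬ IsB0 b → dist1 ((c K k (M V) b)⁻¹·V b) < ε₁) then 1 else 0` is measurable, `{0,1}`-valued, history-free and reads (2.9) — packaged as `∃ χ, …`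
(K0c's `measurable_chiFix29SelOfRecord` argument run letter-generically); (§2) FILE 1's axial letter chosen ON ALL TORI AND LEVELS AT ONCE (`choose` over `(K, j)`; above the
standing range `j + 1 ≤ m + K` the family is the Sel letter — junk never read), so that its cut-off family is ONE closed term and the pair `(crit, χ)` is available BEFORE a torus is
fixed; (§3) the pair's per-torus clauses on the small-field domains `domAltOfRecord ν K (j+1)`, `j < K`, in road B's verbatim shapes (`hfib ∕ hcritδ ∕ hcrit` + `hχm ∕ hχ01 ∕ hχ1`),
from the Sel tower's own binders `hsolν` + `hcritSel`, or from the tower-shaped two-radii binders `h11 hreg8` + numerics.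

WHAT IS PROVED (theorems only; 0 `def`, 0 `instance`, 0 `sorry`; axioms standard).
* §1 `measurableSet_thresholdSet_of_measurable` · ★★ `exists_cutoffFamily_of_measurable` (ANY measurable letter family ⇒ `∃ χ` with `hχm`, `hχ01`, history-freeness, `hχ1`).
* §2 ★★ `exists_axialCritCfg_allTori` (FILE 1's six clauses (a)–(f) for ONE family `crit : (K j : ℕ) → …`, measurable at every `(K, j)`, (b)–(f) in the standing range) ·
  ★★★ `exists_axialCritCfg_allTori_with_cutoff` (the pair `(crit, χ)`).
* §3 ★★★ `exists_axialPair_towerBinders_of_hsolν_of_hcritSel` · ★★★ `exists_axialPair_towerBinders_of_thm1_εbg_of_reg8` (per torus `K`: road B's tower binders VERBATIM and in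
  order — `hχm : ∀ g j` · `hχ01 : ∀ g j U` · `hχ1 : ∀ g, ∀ j < K, ∀ V` · `hfib` · `hcritδ` · `hcrit` — then `Measurable (crit K j)` · axiality · (181)ˢᵒˡ, all `j < K`).

HONEST SCOPE ∕ FRAMING.  Count-neutral kernel measurability ∕ bookkeeping BY NAME over NODE 00's definitions and FILE 1; [B11] Thm 1 ONLY as displayed hypotheses (`hsolν`, `h11`,
`hreg8`); numerics DISPLAYED, asserted of no record; NO record edition made and NO cut-off NAMED (the ∃-packaged `χ` serves any later name by `rfl`); NOTHING of Bałaban's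
asserted; N09 NOT discharged; conjunct 1 (Lemma 4) ∕ FLAG №7 untouched; K0⁷ ∕ K1⁹ ∕ K3⁸ NOT closed; counts unmoved (typed 28∕28 · discharged 5∕28); one finite four-torus programme
at fixed `ε = L^{−K}` per run — R4 closes the conditional rung `BalabanLadder.UV` only; NOT ℝ⁴ ∕ infinite volume ∕ OS; the Yang–Mills mass gap (Clay) is NOT proved by any of this.
-/

noncomputable section

open Set Filter Topology MeasureTheory

namespace Summit.QuantumFields.YangMills.BalabanUVNodes.N09AxialLetterCutoffFamily

open Literature.MathematicalPhysics.QuantumFieldTheory.Balaban1983to89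
open Literature.MathematicalPhysics.QuantumFieldTheory.Balaban1983to89.Node00
open Literature.MathematicalPhysics.QuantumFieldTheory.Balaban1983to89.T4Continuum (T4Family)
open Literature.MathematicalPhysics.QuantumFieldTheory.Balaban1983to89.ExpMeanLog (deltaSU)
open Literature.MathematicalPhysics.QuantumFieldTheory.Balaban1983to89.FederbushMean (deltaFed)
open B12RTGaugeInvariance254 (liftTransf)
open GaugeField (gaugeAct)
open Summit.QuantumFields.YangMills.BalabanUVNodes.N09ContinuousAxialCritCfg (exists_axialCritCfg)
open Summit.QuantumFields.YangMills.BalabanUVNodes.N09BackgroundRadiiTransfer (ukExists_of_le_of_Uk_mem)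
open Summit.QuantumFields.YangMills.BalabanUVNodes.N09SelectorContinuousOfThm1TwoRadii (continuousOn_critCfgSelOfRecord_of_thm1_of_reg8)
open Summit.QuantumFields.YangMills.BalabanUVNodes.N09LocalSupportSetAnyCrit (hcritSel_of_ukExists)

variable {F : T4Family} {N : ℕ} [NeZero N]

/-! ## §1. The (2.9)-pattern cut-off family of an ARBITRARY measurable letter family, def-free -/

/-- The (2.9) threshold set `{V | ∀ b ∉ b₀, dist1 ((c (M V) b)⁻¹·V b) < ε₁}` of a MEASURABLE letter `c` is measurable (finitely many measurable strict inequalities; the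
distinguished bonds contribute `univ`).  K0c's `measurable_chiFix29SelOfRecord` argument, letter-generic. [cite: Balaban1987RG1, (2.9) p.266 (bookkeeping)] -/
theorem measurableSet_thresholdSet_of_measurable (K k : ℕ) (ε₁ : ℝ) {c : GaugeField (F.P K) (k + 1) (SU N) → GaugeField (F.P K) k (SU N)} (hc : Measurable c) :
    MeasurableSet {V : GaugeField (F.P K) k (SU N) | ∀ b : PBond (F.P K) k, ¬ IsB0 b → dist1 ((c ((avOfRecord F N K k).avg V) b)⁻¹ * V b) < ε₁} := by
  have hdev : ∀ b : PBond (F.P K) k, Measurable fun V : GaugeField (F.P K) k (SU N) => dist1 ((c ((avOfRecord F N K k).avg V) b)⁻¹ * V b) := by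
    intro b
    have hcrit : Measurable (fun V : GaugeField (F.P K) k (SU N) => c ((avOfRecord F N K k).avg V) b) :=
      (measurable_pi_apply b).comp (hc.comp (avOfRecord_measurable F N K k))
    have hV : Measurable (fun V : GaugeField (F.P K) k (SU N) => V b) := measurable_pi_apply b
    exact RegularGaugeGroup.measurable_dist1.comp (hcrit.inv.mul hV)
  have h : {V : GaugeField (F.P K) k (SU N) | ∀ b : PBond (F.P K) k, ¬ IsB0 b → dist1 ((c ((avOfRecord F N K k).avg V) b)⁻¹ * V b) < ε₁} =
      ⋂ b : PBond (F.P K) k, {V | ¬ IsB0 b → dist1 ((c ((avOfRecord F N K k).avg V) b)⁻¹ * V b) < ε₁} := by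
    ext V
    simp only [mem_setOf_eq, mem_iInter]
  rw [h]
  refine MeasurableSet.iInter fun b => ?_
  by_cases hb : IsB0 b
  · have : {V : GaugeField (F.P K) k (SU N) | ¬ IsB0 b → dist1 ((c ((avOfRecord F N K k).avg V) b)⁻¹ * V b) < ε₁} = univ :=
      eq_univ_of_forall fun V h0 => absurd hb h0
    rw [this]
    exact MeasurableSet.univ
  · have : {V : GaugeField (F.P K) k (SU N) | ¬ IsB0 b → dist1 ((c ((avOfRecord F N K k).avg V) b)⁻¹ * V b) < ε₁} =
        {V | dist1 ((c ((avOfRecord F N K k).avg V) b)⁻¹ * V b) < ε₁} := by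
      ext V
      simp only [mem_setOf_eq]
      exact ⟨fun h => h hb, fun h _ => h⟩
    rw [this]
    exact measurableSet_lt (hdev b) measurable_const

/-- ★★ **THE (2.9)-PATTERN CUT-OFF FAMILY OF AN ARBITRARY MEASURABLE LETTER FAMILY, DEF-FREE**: for every `c : (K j : ℕ) → GaugeField_{j+1} → GaugeField_j` with
`Measurable (c K j)` there is `χ : (K : ℕ) → (ℕ → ℝ) → (k : ℕ) → Density (F.P K) k (SU N)` — the explicit term «`1` iff every non-distinguished fluctuation variable of `c` is
`ε₁`-small, else `0`» — with, at every `(K, g, k)`: `Measurable (χ K g k)` (road B's `hχm`), `χ K g k U = 0 ∨ χ K g k U = 1` (`hχ01`), history-freeness `χ K g k = χ K g′ k`,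
and the (2.9) reading `χ K g k V = 1 ↔ ∀ b, ¬ IsB0 b → dist1 ((c K k (M V) b)⁻¹·V b) < ε₁` (`hχ1`). [cite: Balaban1987RG1, (2.9) p.266] -/
theorem exists_cutoffFamily_of_measurable (ε₁ : ℝ) {c : (K j : ℕ) → GaugeField (F.P K) (j + 1) (SU N) → GaugeField (F.P K) j (SU N)}
    (hc : ∀ K j, Measurable (c K j)) :
    ∃ χ : (K : ℕ) → (ℕ → ℝ) → (k : ℕ) → Density (F.P K) k (SU N), ∀ (K : ℕ) (g : ℕ → ℝ) (k : ℕ),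
      Measurable (χ K g k) ∧ (∀ U, χ K g k U = 0 ∨ χ K g k U = 1) ∧ (∀ g' : ℕ → ℝ, χ K g k = χ K g' k) ∧
      (∀ V, χ K g k V = 1 ↔ ∀ b : PBond (F.P K) k, ¬ IsB0 b → dist1 ((c K k ((avOfRecord F N K k).avg V) b)⁻¹ * V b) < ε₁) := by
  classical
  refine ⟨fun K _ k V => if ∀ b : PBond (F.P K) k, ¬ IsB0 b → dist1 ((c K k ((avOfRecord F N K k).avg V) b)⁻¹ * V b) < ε₁ then 1 else 0,
    fun K g k => ⟨?_, fun U => ?_, fun g' => rfl, fun V => ?_⟩⟩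
  · exact Measurable.ite (measurableSet_thresholdSet_of_measurable K k ε₁ (hc K k)) measurable_const measurable_const
  · dsimp only
    split_ifs
    · exact Or.inr rfl
    · exact Or.inl rfl
  · dsimp only
    split_ifs with h
    · exact ⟨fun _ => h, fun _ => rfl⟩
    · exact ⟨fun h1 => absurd h1 zero_ne_one, fun h' => absurd h' h⟩

/-! ## §2. FILE 1's axial letter chosen on ALL tori and levels at once; the pair (letter, cut-off) -/

/-- ★★ **THE AXIAL LETTER ON ALL TORI AND LEVELS AT ONCE**: one family `crit : (K j : ℕ) → GaugeField_{j+1} → GaugeField_j`, measurable at every `(K, j)`, carrying FILE 1's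
clauses (b)–(f) wherever `j + 1 ≤ m + K` (in the fibre on the solvable set at `ν.εreg`; axial for `contourOfRecord F N K j`; (181)ˢᵒˡ-covariant; fine-related to `V^{(j),Sel}` hence
every `PlaqSmall δ` transfers; continuous on every `D` where `V^{(j),Sel}` is continuous with Federbush-admissible small values).  Above the range the family is the Sel letter.
[cite: Balaban1987RG1, (2.3) p.265 and (0.11) p.253; Balaban1985Variational, (181) p.307; Balaban1985RegularSpaces, (1.15) p.78] -/
theorem exists_axialCritCfg_allTori (ν : Stage7Numerics) :
    ∃ crit : (K j : ℕ) → GaugeField (F.P K) (j + 1) (SU N) → GaugeField (F.P K) j (SU N),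
      (∀ K j, Measurable (crit K j)) ∧
      ∀ K j, j + 1 ≤ (F.P K).m + (F.P K).K →
        (∀ W, UkExists F N K (j + 1) ν.εreg W → (avOfRecord F N K j).avg (crit K j W) = W) ∧
        (∀ W, AxialGauge (contourOfRecord F N K j) (crit K j W)) ∧
        (∀ (v : GaugeTransf (F.P K) (j + 1) (SU N)) (W : GaugeField (F.P K) (j + 1) (SU N)),
          UkExists F N K (j + 1) ν.εreg W → UniqueUkOrbit F N K (j + 1) ν.εreg W → crit K j (gaugeAct v W) = gaugeAct (liftTransf v) (crit K j W)) ∧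
        (∀ W, ∃ u : GaugeTransf (F.P K) j (SU N), (∀ y : Site (F.P K) (j + 1), u (emb y) = 1) ∧ crit K j W = gaugeAct u (critCfgSelOfRecord F N ν K j W)) ∧
        (∀ (δ : ℝ) (W : GaugeField (F.P K) (j + 1) (SU N)), PlaqSmall δ (critCfgSelOfRecord F N ν K j W) → PlaqSmall δ (crit K j W)) ∧
        (∀ (D : Set (GaugeField (F.P K) (j + 1) (SU N))) (a : ℝ), 0 ≤ a →
          ((((F.P K).d * (F.P K).L : ℕ) : ℝ)) ^ 2 / 4 * a < deltaFed (Fin N) →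
          (∀ W ∈ D, PlaqSmall a (critCfgSelOfRecord F N ν K j W)) →
          ContinuousOn (critCfgSelOfRecord F N ν K j) D → ContinuousOn (crit K j) D) := by
  have H : ∀ K j : ℕ, ∃ c : GaugeField (F.P K) (j + 1) (SU N) → GaugeField (F.P K) j (SU N), Measurable c ∧
      (j + 1 ≤ (F.P K).m + (F.P K).K →
        (∀ W, UkExists F N K (j + 1) ν.εreg W → (avOfRecord F N K j).avg (c W) = W) ∧
        (∀ W, AxialGauge (contourOfRecord F N K j) (c W)) ∧
        (∀ (v : GaugeTransf (F.P K) (j + 1) (SU N)) (W : GaugeField (F.P K) (j + 1) (SU N)),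
          UkExists F N K (j + 1) ν.εreg W → UniqueUkOrbit F N K (j + 1) ν.εreg W → c (gaugeAct v W) = gaugeAct (liftTransf v) (c W)) ∧
        (∀ W, ∃ u : GaugeTransf (F.P K) j (SU N), (∀ y : Site (F.P K) (j + 1), u (emb y) = 1) ∧ c W = gaugeAct u (critCfgSelOfRecord F N ν K j W)) ∧
        (∀ (δ : ℝ) (W : GaugeField (F.P K) (j + 1) (SU N)), PlaqSmall δ (critCfgSelOfRecord F N ν K j W) → PlaqSmall δ (c W)) ∧
        (∀ (D : Set (GaugeField (F.P K) (j + 1) (SU N))) (a : ℝ), 0 ≤ a →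
          ((((F.P K).d * (F.P K).L : ℕ) : ℝ)) ^ 2 / 4 * a < deltaFed (Fin N) →
          (∀ W ∈ D, PlaqSmall a (critCfgSelOfRecord F N ν K j W)) →
          ContinuousOn (critCfgSelOfRecord F N ν K j) D → ContinuousOn c D)) := by
    intro K j
    by_cases hj : j + 1 ≤ (F.P K).m + (F.P K).K
    · obtain ⟨c, ha, hrest⟩ := exists_axialCritCfg (F := F) (N := N) ν hj
      exact ⟨c, ha, fun _ => hrest⟩
    · exact ⟨critCfgSelOfRecord F N ν K j, measurable_critCfgSelOfRecord ν K j, fun h => absurd h hj⟩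
  choose crit hm hcl using H
  exact ⟨crit, hm, hcl⟩

/-- ★★★ **THE PAIR (AXIAL LETTER, ITS (2.9) CUT-OFF FAMILY)**, both available before a torus is fixed: `∃ crit χ`, `crit` as in `exists_axialCritCfg_allTori` and `χ` its cut-off
family of §1 (`hχm`, `hχ01`, history-free, `hχ1` keyed to `crit K k`). [cite: Balaban1987RG1, (2.3) p.265 and (2.9) p.266] -/
theorem exists_axialCritCfg_allTori_with_cutoff (ν : Stage7Numerics) (ε₁ : ℝ) :
    ∃ (crit : (K j : ℕ) → GaugeField (F.P K) (j + 1) (SU N) → GaugeField (F.P K) j (SU N))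
      (χ : (K : ℕ) → (ℕ → ℝ) → (k : ℕ) → Density (F.P K) k (SU N)),
      (∀ K j, Measurable (crit K j)) ∧
      (∀ K j, j + 1 ≤ (F.P K).m + (F.P K).K →
        (∀ W, UkExists F N K (j + 1) ν.εreg W → (avOfRecord F N K j).avg (crit K j W) = W) ∧
        (∀ W, AxialGauge (contourOfRecord F N K j) (crit K j W)) ∧
        (∀ (v : GaugeTransf (F.P K) (j + 1) (SU N)) (W : GaugeField (F.P K) (j + 1) (SU N)),
          UkExists F N K (j + 1) ν.εreg W → UniqueUkOrbit F N K (j + 1) ν.εreg W → crit K j (gaugeAct v W) = gaugeAct (liftTransf v) (crit K j W)) ∧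
        (∀ W, ∃ u : GaugeTransf (F.P K) j (SU N), (∀ y : Site (F.P K) (j + 1), u (emb y) = 1) ∧ crit K j W = gaugeAct u (critCfgSelOfRecord F N ν K j W)) ∧
        (∀ (δ : ℝ) (W : GaugeField (F.P K) (j + 1) (SU N)), PlaqSmall δ (critCfgSelOfRecord F N ν K j W) → PlaqSmall δ (crit K j W)) ∧
        (∀ (D : Set (GaugeField (F.P K) (j + 1) (SU N))) (a : ℝ), 0 ≤ a →
          ((((F.P K).d * (F.P K).L : ℕ) : ℝ)) ^ 2 / 4 * a < deltaFed (Fin N) →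
          (∀ W ∈ D, PlaqSmall a (critCfgSelOfRecord F N ν K j W)) →
          ContinuousOn (critCfgSelOfRecord F N ν K j) D → ContinuousOn (crit K j) D)) ∧
      (∀ (K : ℕ) (g : ℕ → ℝ) (k : ℕ),
        Measurable (χ K g k) ∧ (∀ U, χ K g k U = 0 ∨ χ K g k U = 1) ∧ (∀ g' : ℕ → ℝ, χ K g k = χ K g' k) ∧
        (∀ V, χ K g k V = 1 ↔ ∀ b : PBond (F.P K) k, ¬ IsB0 b → dist1 ((crit K k ((avOfRecord F N K k).avg V) b)⁻¹ * V b) < ε₁)) := by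
  obtain ⟨crit, hm, hcl⟩ := exists_axialCritCfg_allTori (F := F) (N := N) ν
  obtain ⟨χ, hχ⟩ := exists_cutoffFamily_of_measurable (F := F) (N := N) ε₁ hm
  exact ⟨crit, χ, hm, hcl, hχ⟩

/-! ## §3. Per torus: the pair's clauses on the small-field domains of record, in road B's verbatim binder shapes (`hχm hχ01 hχ1 hfib hcritδ hcrit`) -/

/-- ★★★ **THE AXIAL PAIR's CLAUSES AT A TORUS FROM THE Sel TOWER's OWN BINDERS** (torus `K`; numerics `0 < εreg`, the (53)-pair at `εreg`, `2εreg ≤ δL²`, `((d·L)²∕4)·δ < δ_N`;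
`hsolν`; `hcritSel : ∀ j < K, ContinuousOn (V^{(j),Sel}) domAlt_{j+1}`): a pair `(crit, χ)` on ALL tori whose slice `crit K : (j : ℕ) → GaugeField_{j+1} → GaugeField_j` and `χ` carry,
in THIS ORDER and VERBATIM, road B's letter-parametric tower binders — `hχm : ∀ g j, Measurable (χ K g j)` · `hχ01 : ∀ g j U, χ K g j U = 0 ∨ χ K g j U = 1` ·
`hχ1 : ∀ g, ∀ j < K, ∀ V, χ K g j V = 1 ↔ ∀ b, ¬ IsB0 b → dist1 ((crit K j (M V) b)⁻¹·V b) < ε₁` · `hfib` · `hcritδ` · `hcrit` — followed by the axial extras: `Measurable (crit K j)`,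
`AxialGauge (contourOfRecord F N K j) (crit K j W)` for every `W`, (181)ˢᵒˡ-covariance on `UkExists ∧ UniqueUkOrbit` (all `j < K`).
[cite: Balaban1987RG1, (2.3) p.265, (2.9) p.266 and p.259; Balaban1985Averaging, Prop. 2 (53) p.26; Balaban1985Variational, (181) p.307] -/
theorem exists_axialPair_towerBinders_of_hsolν_of_hcritSel (ν : Stage7Numerics) (ε₁ : ℝ) (K : ℕ) {δ : ℝ} (hε : 0 < ν.εreg)
    (hε3 : (143 * (((((F.P K).d + 4 : ℕ) : ℝ)) ^ 2 / 4) ^ 2) * ν.εreg ≤ 1 / 3)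
    (hε2 : 2 * ν.εreg ≤ 2 * deltaSU (Fin N) / ((((F.P K).d + 4) * (F.P K).L : ℕ) : ℝ) ^ 2) (hδ : 2 * ν.εreg ≤ δ * ((F.P K).L : ℝ) ^ 2)
    (hnum : ((((F.P K).d * (F.P K).L : ℕ) : ℝ)) ^ 2 / 4 * δ < deltaFed (Fin N))
    (hsolν : ∀ j < K, ∀ W ∈ domAltOfRecord F N ν K (j + 1), UkExists F N K (j + 1) ν.εreg W)
    (hcritSel : ∀ j < K, ContinuousOn (critCfgSelOfRecord F N ν K j) (domAltOfRecord F N ν K (j + 1))) :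
    ∃ (crit : (K j : ℕ) → GaugeField (F.P K) (j + 1) (SU N) → GaugeField (F.P K) j (SU N))
      (χ : (K : ℕ) → (ℕ → ℝ) → (k : ℕ) → Density (F.P K) k (SU N)),
      (∀ (g : ℕ → ℝ) (j : ℕ), Measurable (χ K g j)) ∧
      (∀ (g : ℕ → ℝ) (j : ℕ) (U : GaugeField (F.P K) j (SU N)), χ K g j U = 0 ∨ χ K g j U = 1) ∧
      (∀ (g : ℕ → ℝ), ∀ j < K, ∀ V : GaugeField (F.P K) j (SU N),
        χ K g j V = 1 ↔ ∀ b : PBond (F.P K) j, ¬ IsB0 b → dist1 ((crit K j ((avOfRecord F N K j).avg V) b)⁻¹ * V b) < ε₁) ∧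
      (∀ j < K, ∀ W ∈ domAltOfRecord F N ν K (j + 1), (avOfRecord F N K j).avg (crit K j W) = W) ∧
      (∀ j < K, ∀ W ∈ domAltOfRecord F N ν K (j + 1), PlaqSmall δ (crit K j W)) ∧
      (∀ j < K, ContinuousOn (crit K j) (domAltOfRecord F N ν K (j + 1))) ∧
      (∀ j < K, Measurable (crit K j)) ∧
      (∀ j < K, ∀ W, AxialGauge (contourOfRecord F N K j) (crit K j W)) ∧
      (∀ j < K, ∀ (v : GaugeTransf (F.P K) (j + 1) (SU N)) (W : GaugeField (F.P K) (j + 1) (SU N)),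
        UkExists F N K (j + 1) ν.εreg W → UniqueUkOrbit F N K (j + 1) ν.εreg W → crit K j (gaugeAct v W) = gaugeAct (liftTransf v) (crit K j W)) := by
  have hL0 : (0 : ℝ) < (F.P K).L := by exact_mod_cast (F.P K).L_pos
  have hδ0 : 0 ≤ δ := by
    have h2 : 0 ≤ δ * ((F.P K).L : ℝ) ^ 2 := le_trans (by positivity) hδ
    exact nonneg_of_mul_nonneg_left h2 (by positivity)
  obtain ⟨crit, χ, hm, hcl, hχ⟩ := exists_axialCritCfg_allTori_with_cutoff (F := F) (N := N) ν ε₁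
  have hk1 : ∀ j, j < K → j + 1 ≤ (F.P K).m + (F.P K).K := fun j hj => by simp only [T4Family.P_K]; omega
  have hsm : ∀ j, j < K → ∀ W ∈ domAltOfRecord F N ν K (j + 1), PlaqSmall δ (critCfgSelOfRecord F N ν K j W) :=
    fun j hj W hW => hcritSel_of_ukExists ν hj hε hε3 hε2 hδ (hsolν j hj W hW)
  refine ⟨crit, χ, fun g j => (hχ K g j).1, fun g j => (hχ K g j).2.1, fun g j _ => (hχ K g j).2.2.2,
    fun j hj W hW => (hcl K j (hk1 j hj)).1 W (hsolν j hj W hW),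
    fun j hj W hW => (hcl K j (hk1 j hj)).2.2.2.2.1 δ W (hsm j hj W hW),
    fun j hj => (hcl K j (hk1 j hj)).2.2.2.2.2 _ δ hδ0 hnum (hsm j hj) (hcritSel j hj),
    fun j _ => hm K j, fun j hj => (hcl K j (hk1 j hj)).2.1, fun j hj => (hcl K j (hk1 j hj)).2.2.1⟩

/-- ★★★ **… FROM THE TOWER-SHAPED TWO-RADII BINDERS + NUMERICS ONLY** (`h11 hreg8 : ∀ k ≤ K, ∀ V ∈ domAlt_k, …` at `εbg`; `εreg < εbg`, `εreg < α₀`, `α₀` (53)-admissible with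
dag-n09-w1's two loop guards; `0 < εreg`, the (53)-pair at `εreg`, `2εreg ≤ δL²`, `((d·L)²∕4)·δ < δ_N`): the same nine conclusions in the same order — solvability at `εreg`
by `ukExists_of_le_of_Uk_mem`, the Sel letter's continuity by dag-n09-w1 g6's `continuousOn_critCfgSelOfRecord_of_thm1_of_reg8`.
[cite: Balaban1987RG1, (2.3) p.265, (2.9) p.266 and p.259; Balaban1985Variational, Thm 1 (6), (8) p.279 and (181) p.307; Balaban1985Averaging, Prop. 2 (53) p.26] -/
theorem exists_axialPair_towerBinders_of_thm1_εbg_of_reg8 (ν : Stage7Numerics) (ε₁ εbg : ℝ) (K : ℕ) {α₀ δ : ℝ} (hlt : ν.εreg < εbg) (he : ν.εreg < α₀)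
    (hα : 0 < α₀) (hα3 : (143 * (((((F.P K).d + 4 : ℕ) : ℝ)) ^ 2 / 4) ^ 2) * α₀ ≤ 1 / 3)
    (hα2 : 2 * α₀ ≤ 2 * deltaSU (Fin N) / ((((F.P K).d + 4) * (F.P K).L : ℕ) : ℝ) ^ 2)
    (hα24 : ((((F.P K).d + 2) * (F.P K).L : ℕ) : ℝ) ^ 2 / 4 * (2 * α₀) ≤ 1 / 24)
    (hαL : 157 * (((((F.P K).d + 2) * (F.P K).L : ℕ) : ℝ) ^ 2 / 4 * (2 * α₀)) < (((F.P K).L : ℝ) ^ ((F.P K).d - 1))⁻¹)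
    (hε : 0 < ν.εreg) (hε3 : (143 * (((((F.P K).d + 4 : ℕ) : ℝ)) ^ 2 / 4) ^ 2) * ν.εreg ≤ 1 / 3)
    (hε2 : 2 * ν.εreg ≤ 2 * deltaSU (Fin N) / ((((F.P K).d + 4) * (F.P K).L : ℕ) : ℝ) ^ 2) (hδ : 2 * ν.εreg ≤ δ * ((F.P K).L : ℝ) ^ 2)
    (hnum : ((((F.P K).d * (F.P K).L : ℕ) : ℝ)) ^ 2 / 4 * δ < deltaFed (Fin N))
    (h11 : ∀ k, k ≤ K → ∀ V ∈ domAltOfRecord F N ν K k, UkExists F N K k εbg V ∧ UniqueUkOrbit F N K k εbg V)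
    (hreg8 : ∀ k, k ≤ K → ∀ V ∈ domAltOfRecord F N ν K k, Uk F N K k εbg V ∈ bgReg F N K k ν.εreg) :
    ∃ (crit : (K j : ℕ) → GaugeField (F.P K) (j + 1) (SU N) → GaugeField (F.P K) j (SU N))
      (χ : (K : ℕ) → (ℕ → ℝ) → (k : ℕ) → Density (F.P K) k (SU N)),
      (∀ (g : ℕ → ℝ) (j : ℕ), Measurable (χ K g j)) ∧
      (∀ (g : ℕ → ℝ) (j : ℕ) (U : GaugeField (F.P K) j (SU N)), χ K g j U = 0 ∨ χ K g j U = 1) ∧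
      (∀ (g : ℕ → ℝ), ∀ j < K, ∀ V : GaugeField (F.P K) j (SU N),
        χ K g j V = 1 ↔ ∀ b : PBond (F.P K) j, ¬ IsB0 b → dist1 ((crit K j ((avOfRecord F N K j).avg V) b)⁻¹ * V b) < ε₁) ∧
      (∀ j < K, ∀ W ∈ domAltOfRecord F N ν K (j + 1), (avOfRecord F N K j).avg (crit K j W) = W) ∧
      (∀ j < K, ∀ W ∈ domAltOfRecord F N ν K (j + 1), PlaqSmall δ (crit K j W)) ∧
      (∀ j < K, ContinuousOn (crit K j) (domAltOfRecord F N ν K (j + 1))) ∧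
      (∀ j < K, Measurable (crit K j)) ∧
      (∀ j < K, ∀ W, AxialGauge (contourOfRecord F N K j) (crit K j W)) ∧
      (∀ j < K, ∀ (v : GaugeTransf (F.P K) (j + 1) (SU N)) (W : GaugeField (F.P K) (j + 1) (SU N)),
        UkExists F N K (j + 1) ν.εreg W → UniqueUkOrbit F N K (j + 1) ν.εreg W → crit K j (gaugeAct v W) = gaugeAct (liftTransf v) (crit K j W)) := by
  refine exists_axialPair_towerBinders_of_hsolν_of_hcritSel ν ε₁ K hε hε3 hε2 hδ hnum
    (fun j hj W hW => ukExists_of_le_of_Uk_mem hlt.le (h11 (j + 1) hj W hW).1 (hreg8 (j + 1) hj W hW)) fun j hj => ?_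
  have hk1 : j + 1 ≤ (F.P K).m + (F.P K).K := by simp only [T4Family.P_K]; omega
  exact continuousOn_critCfgSelOfRecord_of_thm1_of_reg8 ν K j hlt he hα hα3 hα2 hα24 hαL hk1 (h11 (j + 1) hj) (hreg8 (j + 1) hj)

end Summit.QuantumFields.YangMills.BalabanUVNodes.N09AxialLetterCutoffFamily
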